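import Summits.NavierStokesRegularity.NavierStokesRegularity.Theorems.ExtremiserTransienceLocalMaximiserDefs
import Summits.NavierStokesRegularity.NavierStokesRegularity.Theorems.ExtremiserTransienceKStarAttainedPerturbation
import Literature.Analysis.FluidPDE.BKMClassGradientContinuity
import Literature.Analysis.FluidPDE.VorticityCalculus
import HarnessLib

/-!
# Route `ExtremiserTransience`, crux `NearExtremalTransiencePerFlow` (stmt-NavierStokesRegularity-26567),
# LINE g9-1 «local maximiser» (ideator ns-idea-10 g9): STUB L2 `ThickGoodCentre` PROVED

`thickGoodCentre_holds : ThickGoodCentre` — the line's stub L2 `stub_thickGoodCentre : Sig.ThickGoodCentre` (texts of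
record `…Theorems.ExtremiserTransienceLocalMaximiserDefs`, verbatim the line's `Sig.ThickGoodCentre`), and the glue
`selection_of_localSlack : LocalSlack → Selection` (the line's `selection_of`, L1 being proved in the line file).

## Statement (L2).  In the `A`-regular admissible class (`IsAdm`, `IsReg`) there is `θ₀ = κ⋆/4 > 0` such that for all
`R, η > 0` some `ε₀(A,R,η) > 0` works: if `v` is `(κ⋆−ε)`-extremal with `0 ≤ ε ≤ ε₀` and the local gains of every finite
disjoint admissible test family sum to `≤ εM√Z√W` (slack summability, = the conclusion of L1), then some centre `x₀` has
THICK vorticity `‖curl v x₀‖ ≥ θ₀M/λ` and every admissible test supported in `B(x₀, Rλ)` gains `≤ ηM³` (`λ = lam v = √(Z/W)`).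

## Proof (elementary; no grid colouring).  Suppose every thick point carries a bad test (gain `> ηM³`) inside its `Rλ`-ball.
1. THIN/THICK SPLIT (`thick_enstrophy_lower_bound`): pointwise `ω·Dv ω ≤ ‖ω‖²‖Dv‖`; on the thin set `‖ω‖ < θ₀M/λ` this is
   `≤ (θ₀M/λ)·(‖ω‖² + |Dv|_F²)/2`, on the thick set `Θ` it is `≤ (A₁M/λ)‖ω‖²` (`‖Dv‖ ≤ A₁M/λ` = `IsReg` at `j = 1`);
   integrating with `∫|Dv|_F² = ∫‖ω‖² = Z` (tree `integral_frobeniusNormSq_fderiv_eq_integral_norm_curl_sq`) and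
   `Z/λ = √Z√W` gives `(κ⋆ − ε − θ₀)M√Z√W ≤ (A₁M/λ)·∫_Θ ‖ω‖²`.
2. SEPARATED SETS ARE SMALL: for a finite `2Rλ`-separated `P ⊆ Θ` the bad tests at its points have pairwise disjoint
   supports (disjoint `Rλ`-balls), so slack summability gives `#P · ηM³ ≤ εM√Z√W`.
3. COVER (`exists_separated_finset_cover`): a `2Rλ`-separated finite `P ⊆ Θ` of MAXIMAL cardinality (cardinalities are
   bounded by step 2) covers `Θ` by the balls `B(p, 2Rλ)`; hence `∫_Θ‖ω‖² ≤ #P · (‖curlCLM‖A₁M/λ)² · vol B(0,2Rλ)`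
   (`setIntegral_biUnion_ball_le`, `norm_curl_le`, `Measure.addHaar_ball_of_pos`).
4. The powers of `λ` and `M` cancel: `κ⋆ − ε − θ₀ ≤ K ε/η` with `K = 8‖curlCLM‖²A₁³R³·vol B₁`; with `θ₀ = κ⋆/4` and
   `ε ≤ ε₀ = min(κ⋆/4, κ⋆η/(4(K+1)))` this contradicts `κ⋆ > 0` (tree `KStar.HalfSpace.kStar_pos`).

Landed `--supports stmt-NavierStokesRegularity-26567` by prover seat `ns-net-p1` (g14).  HONEST FRAMING: a lemma about
ONE admissible vector field; nothing about Navier–Stokes regularity or blow-up is proved here; no summit is proved by a line.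
-/

noncomputable section

open scoped Topology InnerProductSpace RealInnerProductSpace ENNReal ContDiff
open MeasureTheory Filter Set Metric
open Literature.Analysis.FluidPDE
open Summit.NavierStokesRegularity.NavierStokesRegularity.Theorems.DepletionLadder
open Summit.NavierStokesRegularity.NavierStokesRegularity.Theorems.DepletionLadder.KStar.HalfSpace
open Summit.NavierStokesRegularity.NavierStokesRegularity.Theorems.DepletionLadder.KStar.BangBang

namespace Summit.NavierStokesRegularity.NavierStokesRegularity.Theorems.NearExtremalTransiencePerFlow.LocalMaximiser

-- the problem directory repeats the summit name (`NavierStokesRegularity/NavierStokesRegularity`)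
set_option linter.dupNamespace false

/-! ## 1. A maximal separated finite set covers (pure metric-space combinatorics) -/

/-- **Maximal separated sets cover.**  If the `r`-separated finite subsets of a set `S` in a metric space have bounded
cardinality, then some `r`-separated finite `P ⊆ S` covers `S` by the open balls `B(p, r)`, `p ∈ P` (take `P` of maximal
cardinality: an uncovered point of `S` could be added). [folklore] -/
theorem exists_separated_finset_cover {X : Type*} [MetricSpace X] {S : Set X} {r : ℝ} (hr : 0 < r) {N : ℕ}
    (hN : ∀ P : Finset X, (↑P : Set X) ⊆ S → (∀ p ∈ P, ∀ q ∈ P, p ≠ q → r ≤ dist p q) → P.card ≤ N) :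
    ∃ P : Finset X, (↑P : Set X) ⊆ S ∧ (∀ p ∈ P, ∀ q ∈ P, p ≠ q → r ≤ dist p q) ∧
      S ⊆ ⋃ p ∈ P, Metric.ball p r := by
  classical
  set K : Set ℕ := {k | ∃ P : Finset X, (↑P : Set X) ⊆ S ∧ (∀ p ∈ P, ∀ q ∈ P, p ≠ q → r ≤ dist p q) ∧ P.card = k}
    with hK
  have hne : K.Nonempty := ⟨0, ∅, by simp, by simp, rfl⟩
  have hbdd : BddAbove K := by
    refine ⟨N, fun k hk => ?_⟩
    obtain ⟨P, hPS, hPsep, hPk⟩ := hk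
    exact hPk ▸ hN P hPS hPsep
  obtain ⟨P, hPS, hPsep, hPcard⟩ := Nat.sSup_mem hne hbdd
  refine ⟨P, hPS, hPsep, fun x hx => ?_⟩
  by_contra hxU
  have hfar : ∀ p ∈ P, r ≤ dist x p := fun p hp => by
    by_contra hlt
    exact hxU (Set.mem_iUnion₂.2 ⟨p, hp, Metric.mem_ball.2 (lt_of_not_ge hlt)⟩)
  have hxP : x ∉ P := fun hxP => by
    have h := hfar x hxP
    rw [dist_self] at h
    exact absurd h (not_le.2 hr)
  have hins : (insert x P).card ∈ K := by
    refine ⟨insert x P, ?_, ?_, rfl⟩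
    · rw [Finset.coe_insert]
      exact Set.insert_subset hx hPS
    · intro p hp q hq hpq
      rcases Finset.mem_insert.1 hp with rfl | hp'
      · rcases Finset.mem_insert.1 hq with rfl | hq'
        · exact absurd rfl hpq
        · exact hfar q hq'
      · rcases Finset.mem_insert.1 hq with rfl | hq'
        · rw [dist_comm]; exact hfar p hp'
        · exact hPsep p hp' q hq' hpq
  have hle : (insert x P).card ≤ sSup K := le_csSup hbdd hins
  rw [Finset.card_insert_of_notMem hxP, hPcard] at hle
  omega

/-! ## 2. Local enstrophy on a finite union of balls -/

/-- **Enstrophy of a finite union of equal balls** under a pointwise bound `‖curl v‖² ≤ C`: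
`∫_{⋃_{p∈P} B(p,r)} ‖curl v‖² ≤ C · #P · r³ · vol B(0,1)` (subadditivity + scaling of Lebesgue measure on `ℝ³`). [folklore] -/
theorem setIntegral_biUnion_ball_le {v : E3 → E3} {C r : ℝ} (P : Finset E3) (hr : 0 < r)
    (hC : ∀ x, ‖curl v x‖ ^ 2 ≤ C) :
    ∫ x in ⋃ p ∈ P, Metric.ball p r, ‖curl v x‖ ^ 2 ≤
      C * ((P.card : ℝ) * (r ^ 3 * (volume (Metric.ball (0 : E3) 1)).toReal)) := by
  set U : Set E3 := ⋃ p ∈ P, Metric.ball p r with hU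
  have hC0 : 0 ≤ C := (sq_nonneg _).trans (hC 0)
  have hvolball : ∀ p : E3, volume (Metric.ball p r) = ENNReal.ofReal (r ^ 3) * volume (Metric.ball (0 : E3) 1) := by
    intro p
    rw [Measure.addHaar_ball_of_pos volume p hr, finrank_euclideanSpace, Fintype.card_fin]
  have hsum : ∑ p ∈ P, volume (Metric.ball p r) =
      (P.card : ℝ≥0∞) * (ENNReal.ofReal (r ^ 3) * volume (Metric.ball (0 : E3) 1)) := by
    rw [Finset.sum_congr rfl fun p _ => hvolball p, Finset.sum_const, nsmul_eq_mul]
  have hUle : volume U ≤ (P.card : ℝ≥0∞) * (ENNReal.ofReal (r ^ 3) * volume (Metric.ball (0 : E3) 1)) :=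
    (measure_biUnion_finset_le P fun p => Metric.ball p r).trans (le_of_eq hsum)
  have hfin : (P.card : ℝ≥0∞) * (ENNReal.ofReal (r ^ 3) * volume (Metric.ball (0 : E3) 1)) < ⊤ :=
    ENNReal.mul_lt_top (ENNReal.natCast_lt_top _) (ENNReal.mul_lt_top ENNReal.ofReal_lt_top measure_ball_lt_top)
  have hUlt : volume U < ⊤ := lt_of_le_of_lt hUle hfin
  have hreal : (volume U).toReal ≤ (P.card : ℝ) * (r ^ 3 * (volume (Metric.ball (0 : E3) 1)).toReal) := by
    have h := ENNReal.toReal_mono hfin.ne hUle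
    rwa [ENNReal.toReal_mul, ENNReal.toReal_mul, ENNReal.toReal_natCast,
      ENNReal.toReal_ofReal (by positivity)] at h
  have hbound : ‖∫ x in U, ‖curl v x‖ ^ 2‖ ≤ C * (volume U).toReal :=
    norm_setIntegral_le_of_norm_le_const hUlt fun x _ => by
      rw [Real.norm_eq_abs, abs_of_nonneg (sq_nonneg _)]; exact hC x
  calc ∫ x in U, ‖curl v x‖ ^ 2 ≤ ‖∫ x in U, ‖curl v x‖ ^ 2‖ := Real.le_norm_self _
    _ ≤ C * (volume U).toReal := hbound
    _ ≤ C * ((P.card : ℝ) * (r ^ 3 * (volume (Metric.ball (0 : E3) 1)).toReal)) :=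
        mul_le_mul_of_nonneg_left hreal hC0

/-! ## 3. The thin/thick split of the stretching integral -/

/-- **Thick vorticity carries the stretching.**  For an admissible `A`-regular `v` with `(κ⋆−ε)M√Z√W ≤ J(v)` and any
`θ₀ ≥ 0`, the enstrophy of the thick set `Θ = {‖curl v‖ ≥ θ₀M/λ}` satisfies
`(κ⋆ − ε − θ₀)·M√Z√W ≤ (A₁M/λ)·∫_Θ ‖curl v‖²`.  Ingredients: `ω·Dv ω ≤ ‖ω‖²‖Dv‖`, `‖Dv‖ ≤ A₁M/λ`,
`2‖ω‖‖Dv‖ ≤ ‖ω‖² + |Dv|_F²`, `∫|Dv|_F² = Z` for divergence-free `H²` fields, and `Z/λ = √Z√W`. [folklore] -/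
theorem thick_enstrophy_lower_bound {A : ℕ → ℝ} {v : E3 → E3} {M B ε θ₀ : ℝ}
    (hadm : IsAdm v M B) (hreg : IsReg A v M) (hZ : 0 < Zen v) (hW : 0 < Wpa v) (hθ₀ : 0 ≤ θ₀)
    (hext : (kStar - ε) * M * Real.sqrt (Zen v) * Real.sqrt (Wpa v) ≤ Jst v) :
    (kStar - ε - θ₀) * M * Real.sqrt (Zen v) * Real.sqrt (Wpa v) ≤
      A 1 * M * (lam v)⁻¹ * ∫ x in {x | θ₀ * M * (lam v)⁻¹ ≤ ‖curl v x‖}, ‖curl v x‖ ^ 2 := by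
  obtain ⟨hv, hdiv, hvM, hvB, h0, h1, h2⟩ := hadm
  have hv1 : ContDiff ℝ 1 v := hv.of_le (by norm_cast)
  have hv2 : ContDiff ℝ 2 v := hv.of_le (by norm_cast)
  have hM : 0 ≤ M := (norm_nonneg _).trans (hvM 0)
  have hl : 0 < lam v := Real.sqrt_pos.2 (div_pos hZ hW)
  have hsZ : 0 < Real.sqrt (Zen v) := Real.sqrt_pos.2 hZ
  have hsW : 0 < Real.sqrt (Wpa v) := Real.sqrt_pos.2 hW
  -- `‖Dv‖ ≤ A₁ M / λ`
  have hDv : ∀ x, ‖fderiv ℝ v x‖ ≤ A 1 * M * (lam v)⁻¹ := fun x => by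
    have h := hreg 1 x
    rwa [norm_iteratedFDeriv_one, pow_one] at h
  -- the thick set
  set Θ : Set E3 := {x | θ₀ * M * (lam v)⁻¹ ≤ ‖curl v x‖} with hΘ
  have hΘm : MeasurableSet Θ :=
    (isClosed_le continuous_const (continuous_curl hv1).norm).measurableSet
  -- integrability and the identity `∫ |Dv|_F² = Z`
  have hsd : Integrable (fun x => ⟪curl v x, fderiv ℝ v x (curl v x)⟫_ℝ) := KStar.integrable_stretching hv hvB h1
  have hω2 : Integrable (fun x => ‖curl v x‖ ^ 2) := (integrable_norm_curl_sq hv2 h1).1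
  have h0' : ∫⁻ x, ‖v x‖ₑ ^ 2 < ⊤ := by
    refine lt_of_le_of_lt (le_of_eq (lintegral_congr fun x => ?_)) h0
    rw [← ofReal_norm, ← ofReal_norm, norm_iteratedFDeriv_zero]
  have hid : ∫ x, frobeniusNormSq (fderiv ℝ v x) = Zen v :=
    integral_frobeniusNormSq_fderiv_eq_integral_norm_curl_sq hv2 hdiv h0' h1 h2
  have hF : Integrable (fun x => frobeniusNormSq (fderiv ℝ v x)) := by
    by_contra h
    rw [integral_undef h] at hid
    exact hZ.ne hid
  -- the dominating function
  set g : E3 → ℝ := fun x => θ₀ * M * (lam v)⁻¹ * ((‖curl v x‖ ^ 2 + frobeniusNormSq (fderiv ℝ v x)) / 2) +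
      A 1 * M * (lam v)⁻¹ * Θ.indicator (fun x => ‖curl v x‖ ^ 2) x with hg
  have hgi : Integrable g :=
    (((hω2.add hF).div_const 2).const_mul _).add ((hω2.indicator hΘm).const_mul _)
  have hpt : ∀ x, ⟪curl v x, fderiv ℝ v x (curl v x)⟫_ℝ ≤ g x := by
    intro x
    have hin : ⟪curl v x, fderiv ℝ v x (curl v x)⟫_ℝ ≤ ‖curl v x‖ * (‖fderiv ℝ v x‖ * ‖curl v x‖) :=
      (real_inner_le_norm _ _).trans
        (mul_le_mul_of_nonneg_left ((fderiv ℝ v x).le_opNorm _) (norm_nonneg _))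
    have hω0 : 0 ≤ ‖curl v x‖ := norm_nonneg _
    have hD0 : 0 ≤ ‖fderiv ℝ v x‖ := norm_nonneg _
    have hFr : ‖fderiv ℝ v x‖ ^ 2 ≤ frobeniusNormSq (fderiv ℝ v x) := sq_opNorm_le_frobeniusNormSq _
    have hFr0 : 0 ≤ frobeniusNormSq (fderiv ℝ v x) := frobeniusNormSq_nonneg _
    have hc1 : 0 ≤ θ₀ * M * (lam v)⁻¹ := by positivity
    have hc2 : 0 ≤ A 1 * M * (lam v)⁻¹ := hD0.trans (hDv x)
    by_cases hx : x ∈ Θ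
    · -- thick point: `ω·Dv ω ≤ ‖Dv‖‖ω‖² ≤ (A₁M/λ)‖ω‖²`
      have hind : Θ.indicator (fun x => ‖curl v x‖ ^ 2) x = ‖curl v x‖ ^ 2 := Set.indicator_of_mem hx _
      have hthick : ‖curl v x‖ * (‖fderiv ℝ v x‖ * ‖curl v x‖) ≤ A 1 * M * (lam v)⁻¹ * ‖curl v x‖ ^ 2 := by
        rw [show ‖curl v x‖ * (‖fderiv ℝ v x‖ * ‖curl v x‖) = ‖fderiv ℝ v x‖ * ‖curl v x‖ ^ 2 by ring]
        exact mul_le_mul_of_nonneg_right (hDv x) (sq_nonneg _)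
      have hfirst : 0 ≤ θ₀ * M * (lam v)⁻¹ * ((‖curl v x‖ ^ 2 + frobeniusNormSq (fderiv ℝ v x)) / 2) := by
        positivity
      simp only [hg, hind]
      linarith
    · -- thin point: `‖ω‖ < θ₀M/λ` and `2‖Dv‖‖ω‖ ≤ ‖ω‖² + |Dv|_F²`
      have hlt : ‖curl v x‖ < θ₀ * M * (lam v)⁻¹ := lt_of_not_ge hx
      have hind : Θ.indicator (fun x => ‖curl v x‖ ^ 2) x = 0 := Set.indicator_of_notMem hx _
      have hstep : ‖curl v x‖ * (‖fderiv ℝ v x‖ * ‖curl v x‖) ≤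
          θ₀ * M * (lam v)⁻¹ * (‖fderiv ℝ v x‖ * ‖curl v x‖) :=
        mul_le_mul_of_nonneg_right hlt.le (by positivity)
      have hamgm : ‖fderiv ℝ v x‖ * ‖curl v x‖ ≤ (‖curl v x‖ ^ 2 + frobeniusNormSq (fderiv ℝ v x)) / 2 := by
        nlinarith [sq_nonneg (‖fderiv ℝ v x‖ - ‖curl v x‖)]
      simp only [hg, hind, mul_zero, add_zero]
      exact hin.trans (hstep.trans (mul_le_mul_of_nonneg_left hamgm hc1))
  -- integrate
  have hJ : Jst v ≤ ∫ x, g x := integral_mono hsd hgi hpt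
  have iA : Integrable (fun x => θ₀ * M * (lam v)⁻¹ * ((‖curl v x‖ ^ 2 + frobeniusNormSq (fderiv ℝ v x)) / 2)) :=
    ((hω2.add hF).div_const 2).const_mul _
  have iB : Integrable (fun x => A 1 * M * (lam v)⁻¹ * Θ.indicator (fun x => ‖curl v x‖ ^ 2) x) :=
    (hω2.indicator hΘm).const_mul _
  have hgint : ∫ x, g x = θ₀ * M * (lam v)⁻¹ * Zen v + A 1 * M * (lam v)⁻¹ * ∫ x in Θ, ‖curl v x‖ ^ 2 := by
    simp only [hg]
    rw [integral_add iA iB, integral_const_mul, integral_const_mul,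
      integral_div (2 : ℝ) (fun x => ‖curl v x‖ ^ 2 + frobeniusNormSq (fderiv ℝ v x)),
      integral_add hω2 hF, hid, integral_indicator hΘm]
    unfold Zen
    ring
  -- `Z / λ = √Z √W`
  have hlamZ : (lam v)⁻¹ * Zen v = Real.sqrt (Zen v) * Real.sqrt (Wpa v) := by
    have hlam : lam v = Real.sqrt (Zen v) / Real.sqrt (Wpa v) := by
      unfold lam; exact Real.sqrt_div' (Zen v) hW.le
    rw [hlam, inv_div, div_mul_eq_mul_div, mul_div_assoc, Real.div_sqrt, mul_comm]
  have hθ : θ₀ * M * (lam v)⁻¹ * Zen v = θ₀ * M * (Real.sqrt (Zen v) * Real.sqrt (Wpa v)) := by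
    rw [mul_assoc, hlamZ]
  rw [hgint] at hJ
  linarith [hJ, hext, hθ]

/-! ## 4. L2 proved -/

/-- **L2 `ThickGoodCentre` holds** (the line's `stub_thickGoodCentre`, texts of record verbatim): with `θ₀ = κ⋆/4` and
`ε₀ = min(κ⋆/4, κ⋆η/(4(K+1)))`, `K = 8‖curlCLM‖²A₁³R³·vol B(0,1)`, slack summability at level `ε ≤ ε₀` forces a centre
of thick vorticity all of whose admissible tests inside `B(x₀, Rλ)` gain at most `ηM³`.  Proof: steps 1–4 of the module
docstring (thin/thick split, separated sets are small, maximal separated cover, cancellation of the powers of `λ, M`). -/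
theorem thickGoodCentre_holds : ThickGoodCentre := by
  intro A hA
  have hκ : 0 < kStar := kStar_pos
  refine ⟨kStar / 4, by positivity, ?_⟩
  intro R η hR hη
  -- constants of the problem
  set b : ℝ := (volume (Metric.ball (0 : E3) 1)).toReal with hb
  have hb0 : 0 ≤ b := ENNReal.toReal_nonneg
  have hcω0 : 0 ≤ ‖curlCLM‖ := norm_nonneg curlCLM
  set cω : ℝ := ‖curlCLM‖ with hcω
  have hA1 : 0 < A 1 := lt_of_lt_of_le one_pos (hA 1)
  set K : ℝ := 8 * cω ^ 2 * A 1 ^ 3 * R ^ 3 * b with hK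
  have hK0 : 0 ≤ K := by positivity
  refine ⟨min (kStar / 4) (kStar * η / (4 * (K + 1))), lt_min (by positivity) (by positivity), ?_⟩
  intro v M B ε hadm hreg hZ hW hε0 hε hext hslack
  have hε1 : ε ≤ kStar / 4 := hε.trans (min_le_left _ _)
  have hε2 : ε ≤ kStar * η / (4 * (K + 1)) := hε.trans (min_le_right _ _)
  obtain ⟨hv, hdiv, hvM, hvB, h0, h1, h2⟩ := id hadm
  have hv1 : ContDiff ℝ 1 v := hv.of_le (by norm_cast)
  have hv2 : ContDiff ℝ 2 v := hv.of_le (by norm_cast)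
  -- positivity of `λ`, `M`, `√Z√W`
  have hl : 0 < lam v := Real.sqrt_pos.2 (div_pos hZ hW)
  have hM : 0 < M := by
    by_contra hM'
    have hM0 : M ≤ 0 := not_lt.1 hM'
    have hv0 : v = 0 := by
      funext x
      exact norm_le_zero_iff.1 ((hvM x).trans hM0)
    have hZ0 : Zen v = 0 := by
      unfold Zen; simp [hv0]
    exact hZ.ne' hZ0
  have hS : 0 < Real.sqrt (Zen v) * Real.sqrt (Wpa v) := mul_pos (Real.sqrt_pos.2 hZ) (Real.sqrt_pos.2 hW)
  -- `‖Dv‖ ≤ A₁M/λ` and `‖ω‖² ≤ (‖curlCLM‖ A₁ M/λ)²`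
  have hDv : ∀ x, ‖fderiv ℝ v x‖ ≤ A 1 * M * (lam v)⁻¹ := fun x => by
    have h := hreg 1 x
    rwa [norm_iteratedFDeriv_one, pow_one] at h
  have hωbd : ∀ x, ‖curl v x‖ ^ 2 ≤ (cω * (A 1 * M * (lam v)⁻¹)) ^ 2 := fun x => by
    have h₁ : ‖curl v x‖ ≤ cω * ‖fderiv ℝ v x‖ := Literature.Analysis.FluidPDE.norm_curl_le v x
    have h₂ : cω * ‖fderiv ℝ v x‖ ≤ cω * (A 1 * M * (lam v)⁻¹) := mul_le_mul_of_nonneg_left (hDv x) hcω0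
    exact pow_le_pow_left₀ (norm_nonneg _) (h₁.trans h₂) 2
  -- the thick set and the contradiction hypothesis
  set Θ : Set E3 := {x | kStar / 4 * M * (lam v)⁻¹ ≤ ‖curl v x‖} with hΘ
  by_contra hneg
  push Not at hneg
  -- a bad test at every thick point
  have hchoice : ∀ x : E3, ∃ φ : E3 → E3, x ∈ Θ →
      (IsTestAt v M φ ∧ tsupport φ ⊆ Metric.ball x (R * lam v) ∧
        η * M ^ 3 < locGain (kStar * M) (lam v) v φ) := by
    intro x
    by_cases hx : x ∈ Θ
    · obtain ⟨φ, hφ⟩ := hneg x hx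
      exact ⟨φ, fun _ => hφ⟩
    · exact ⟨0, fun h => absurd h hx⟩
  choose f hf using hchoice
  -- step 2: separated subsets of `Θ` are small
  have hcard : ∀ P : Finset E3, (↑P : Set E3) ⊆ Θ →
      (∀ p ∈ P, ∀ q ∈ P, p ≠ q → 2 * (R * lam v) ≤ dist p q) →
      (P.card : ℝ) * (η * M ^ 3) ≤ ε * M * Real.sqrt (Zen v) * Real.sqrt (Wpa v) := by
    intro P hPΘ hPsep
    classical
    set e := P.equivFin with he
    set φ : Fin P.card → E3 → E3 := fun i => f ((e.symm i : P) : E3) with hφ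
    have hmem : ∀ i : Fin P.card, ((e.symm i : P) : E3) ∈ Θ := fun i => hPΘ (e.symm i).2
    have htest : ∀ i, IsTestAt v M (φ i) := fun i => (hf _ (hmem i)).1
    have hdisj : ∀ i j, i ≠ j → Disjoint (tsupport (φ i)) (tsupport (φ j)) := by
      intro i j hij
      have hne : ((e.symm i : P) : E3) ≠ ((e.symm j : P) : E3) := fun h =>
        hij (e.symm.injective (Subtype.ext h))
      have hd := hPsep _ (e.symm i).2 _ (e.symm j).2 hne
      exact Set.disjoint_of_subset (hf _ (hmem i)).2.1 (hf _ (hmem j)).2.1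
        (Metric.ball_disjoint_ball (by linarith))
    have hs := hslack P.card φ htest hdisj
    have hlow : ∑ _i : Fin P.card, η * M ^ 3 ≤ ∑ i, locGain (kStar * M) (lam v) v (φ i) :=
      Finset.sum_le_sum fun i _ => (hf _ (hmem i)).2.2.le
    rw [Finset.sum_const, Finset.card_univ, Fintype.card_fin, nsmul_eq_mul] at hlow
    linarith
  have hN : ∀ P : Finset E3, (↑P : Set E3) ⊆ Θ →
      (∀ p ∈ P, ∀ q ∈ P, p ≠ q → 2 * (R * lam v) ≤ dist p q) →
      P.card ≤ ⌊ε * M * Real.sqrt (Zen v) * Real.sqrt (Wpa v) / (η * M ^ 3)⌋₊ := by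
    intro P hPΘ hPsep
    refine Nat.le_floor ?_
    rw [le_div_iff₀ (by positivity)]
    exact hcard P hPΘ hPsep
  -- step 3: a maximal separated finite set covers `Θ`
  obtain ⟨P, hPΘ, hPsep, hcov⟩ :=
    exists_separated_finset_cover (S := Θ) (by positivity : (0 : ℝ) < 2 * (R * lam v)) hN
  have hω2 : Integrable (fun x => ‖curl v x‖ ^ 2) := (integrable_norm_curl_sq hv2 h1).1
  have hZΘ : ∫ x in Θ, ‖curl v x‖ ^ 2 ≤ ∫ x in ⋃ p ∈ P, Metric.ball p (2 * (R * lam v)), ‖curl v x‖ ^ 2 :=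
    setIntegral_mono_set hω2.integrableOn (Eventually.of_forall fun x => sq_nonneg _) hcov.eventuallyLE
  have hU := setIntegral_biUnion_ball_le (v := v) P (by positivity : (0 : ℝ) < 2 * (R * lam v)) hωbd
  -- step 1: the thin/thick split
  have hC := thick_enstrophy_lower_bound (θ₀ := kStar / 4) hadm hreg hZ hW (by positivity) hext
  -- step 4: cancel the powers of `λ` and `M`
  have hprod : A 1 * M * (lam v)⁻¹ *
      ((cω * (A 1 * M * (lam v)⁻¹)) ^ 2 * ((P.card : ℝ) * ((2 * (R * lam v)) ^ 3 * b))) =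
      K * M ^ 3 * P.card := by
    rw [hK]
    field_simp
    ring
  have hmain : (kStar - ε - kStar / 4) * M * Real.sqrt (Zen v) * Real.sqrt (Wpa v) ≤ K * M ^ 3 * P.card :=
    calc (kStar - ε - kStar / 4) * M * Real.sqrt (Zen v) * Real.sqrt (Wpa v)
        ≤ A 1 * M * (lam v)⁻¹ * ∫ x in Θ, ‖curl v x‖ ^ 2 := hC
      _ ≤ A 1 * M * (lam v)⁻¹ *
          ((cω * (A 1 * M * (lam v)⁻¹)) ^ 2 * ((P.card : ℝ) * ((2 * (R * lam v)) ^ 3 * b))) :=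
          mul_le_mul_of_nonneg_left (hZΘ.trans hU) (by positivity)
      _ = K * M ^ 3 * P.card := hprod
  have hcP := hcard P hPΘ hPsep
  have h3 : K * M ^ 3 * P.card ≤ K * ε / η * (M * (Real.sqrt (Zen v) * Real.sqrt (Wpa v))) := by
    have h := mul_le_mul_of_nonneg_left hcP (div_nonneg hK0 hη.le)
    have e1 : K / η * ((P.card : ℝ) * (η * M ^ 3)) = K * M ^ 3 * P.card := by
      field_simp
    have e2 : K / η * (ε * M * Real.sqrt (Zen v) * Real.sqrt (Wpa v)) =
        K * ε / η * (M * (Real.sqrt (Zen v) * Real.sqrt (Wpa v))) := by ring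
    linarith [h, e1, e2]
  have h4 : kStar - ε - kStar / 4 ≤ K * ε / η := by
    have h := hmain.trans h3
    have e3 : (kStar - ε - kStar / 4) * M * Real.sqrt (Zen v) * Real.sqrt (Wpa v) =
        (kStar - ε - kStar / 4) * (M * (Real.sqrt (Zen v) * Real.sqrt (Wpa v))) := by ring
    rw [e3] at h
    exact le_of_mul_le_mul_right h (mul_pos hM hS)
  have h5 : K * ε / η ≤ kStar / 4 := by
    have h6 : K * ε / η ≤ K * (kStar * η / (4 * (K + 1))) / η := by gcongr
    have e5 : K * (kStar * η / (4 * (K + 1))) / η = kStar / 4 * (K / (K + 1)) := by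
      field_simp
    have h7 : K / (K + 1) ≤ 1 := by
      rw [div_le_one (by linarith)]
      linarith
    calc K * ε / η ≤ K * (kStar * η / (4 * (K + 1))) / η := h6
      _ = kStar / 4 * (K / (K + 1)) := e5
      _ ≤ kStar / 4 * 1 := mul_le_mul_of_nonneg_left h7 (by positivity)
      _ = kStar / 4 := mul_one _
  linarith [h4, h5, hε1, hκ]

/-! ## 5. Glue: L1 + L2 ⇒ the selection L3 consumes -/

/-- **`LocalSlack → Selection`** (the line's `selection_of`, with L2 discharged by `thickGoodCentre_holds`): the local slack
inequality L1 — proved in the line file `Cruxes/NearExtremalTransience/Lines/local_maximiser.lean` (`localSlack_holds`),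
not yet ported to `Theorems/` — turns L2 into the thick-good-centre SELECTION that L3 `Extraction` consumes. -/
theorem selection_of_localSlack (h1 : LocalSlack) : Selection := by
  intro A hA
  obtain ⟨θ₀, hθ₀, h⟩ := thickGoodCentre_holds A hA
  refine ⟨θ₀, hθ₀, fun R η hR hη => ?_⟩
  obtain ⟨ε₀, hε₀, h'⟩ := h R η hR hη
  refine ⟨ε₀, hε₀, fun v M B ε hadm hreg hZ hW hε0 hε hext => ?_⟩
  exact h' v M B ε hadm hreg hZ hW hε0 hε hext fun k φ hφ hdisj => h1 v M B ε k φ hadm hZ hW hext hφ hdisj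

end Summit.NavierStokesRegularity.NavierStokesRegularity.Theorems.NearExtremalTransiencePerFlow.LocalMaximiser

end
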